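import Summits.BirchSwinnertonDyer.Rank1Residual.Additive.XGordRankOneZeroCyclotomicThreeLowerKFacts
import HarnessLib

/-!
# (S8), class forms on N11's (G-ord)@3 rows: `Typed.MissingLowerBoundAt W 3` and `BSD(W,3)` on
# X4♯(G-ord)@3 ∧ `surj(3) ∧ ram(3)`, `r_an(W) = 1`, twist `E♭` of analytic rank ZERO — anomalous rows
# INCLUDED (cell `b2b-bsdres`, team n1011, seat p16; OWNERS row T-N11-GK3LOW, sub-target (S8))

HONEST FRAMING (cell `b2b-bsdres`, run/shared/lean/b2b/bsd-rank1-residual/, verbatim in every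
file): the goal of the cell is to DELETE the COMBINATION-SHAPED residual classes of the
Birch–Swinnerton-Dyer formula for ALL analytic-rank `≤ 1` elliptic curves over `ℚ` — "full BSD
formula for every rank `≤ 1` curve in class `C`" assembled STRICTLY from published theorems — so
that the rank-`≤ 1` remainder becomes exactly the CONSTRUCTION-SHAPED classes, which are TYPED
(missing-input `Prop`s), NOT attempted. This is not "finishing BSD". Team n1011 (N10 / N11 / O7),
seat p16: research route; the labels of X4 and the N11 / O7 marks are UNCHANGED by this file; nothing
is booked here; no Literature fact is minted.

Theorems only (no `def`, no `sorry`, no new named fact). Sequel of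
`XGordRankOneZeroCyclotomicThreeLowerKFacts.lean` in the class vocabulary `ClassX4Gord W 3`: the good
ordinary twist model `(V, C)` of `W^{(−3)}` is obtained from `ClassX4Gord.exists_goodOrd_pStar_twist_model`
(`e = 2` automatic at `3`, `semistabilityIndex_eq_two_of_typeG_three`) and a twisting transport `Tr`
doubling Néron–Tate heights EXISTS (`exists_twistTransport`, `√−3 ∈ ℚ(ζ₃)` by `exists_sq_eq_pStar`); so the
typed inputs (⊇/K) (`hLowK`) and the Schneider/K reading (`hS1K`) become per-row binders over ALL such
`(V, C)` and ALL such `Tr` (true in print for every choice: Schneider's height of `V_K` restricts along every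
height-doubling transport to Delbourgo's height of `W`, `W(ℚ)` having rank one), while p01's typed GZ
`BranchPAdicGrossZagierOddAt W 3 Dh`, the Schneider rider and (for `BSD(W,3)`) a Delbourgo (B)-datum
`LeadingTermClauses W 3 Dh` are row statements on `W`. Named facts as in the Facts file.

* `ClassX4Gord.missingLowerBoundAt_three_rankOne_twistRankZero_of_lowerK_of_schneiderK` —
  **`Typed.MissingLowerBoundAt W 3`** (UPPER half of `V` discharged: Wuthrich Prop. 21);
* `ClassX4Gord.bsdp_three_rankOne_twistRankZero_of_lowerK_of_schneiderK_of_katoHalf` — **`BSD(W,3)`**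
  (p01's UPPER half over Kato's half-eigen reading + the (B)-datum).

Nothing booked; O7 / X4♯(G-ord) stay CONSTRUCTION-SHAPED.
-/

noncomputable section

open scoped Classical MatrixGroups ModularForm

open CongruenceSubgroup WeierstrassCurve WeierstrassCurve.Affine.Point NumberField IsDedekindDomain
  Literature.NumberTheory.EllipticCurves Literature.NumberTheory.EllipticCurves.ModularForms
  Literature.NumberTheory.EllipticCurves.Rank1Residual
  Literature.NumberTheory.EllipticCurves.Rank1Residual.Typed
  Literature.NumberTheory.EllipticCurves.Delbourgo2002
  Literature.NumberTheory.GaloisRepresentations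

namespace Summit.BirchSwinnertonDyer.Rank1Residual.Additive

/-! ## Class forms on N11's (G-ord)@3 rows (per-row binders over all twist models and transports) -/

section ClassForms

variable {W : WeierstrassCurve ℚ} [W.IsElliptic] [W.IsGloballyMinimal]

/- The residual input (⊇/K) for ALL good ordinary twist models `V` of `W^{(−3)}` over `K = CyclotomicField 3 ℚ`. -/
variable
    (hLowK : ∀ (V : WeierstrassCurve ℚ) [V.IsElliptic] [V.IsGloballyMinimal] (C : VariableChange ℚ),
      GoodOrd V 3 → C • V.quadraticTwist (-(3 : ℚ)) = W →
      ∀ {κ : ZpExtension (CyclotomicField 3 ℚ) 3}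
      {γ : Field.absoluteGaloisGroup (CyclotomicField 3 ℚ)} {N : ℕ} [NeZero N]
      {f : CuspForm (Gamma0 N) 2},
      κ.IsCyclotomic → κ.IsTopGenerator γ →
      (∃ ζ : ℤ_[3]ˣ, IsOfFinOrder ζ ∧
        ((GaloisRep.cyclotomicCharacter (CyclotomicField 3 ℚ) 3 γ * ζ : ℤ_[3]ˣ) : ℤ_[3]) =
          (cyclotomicGenerator 3 : ℤ_[3])) →
      IsNewformOf V f →
      ∀ (D : (V.baseChange (CyclotomicField 3 ℚ)).SelmerDualData κ γ) (ϖ ϖ' : ℚ),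
        (ϖ : ℝ) * V.realPeriodRat = plusPeriod f →
        (ϖ' : ℝ) * V.imaginaryPeriodRat = minusPeriod f →
        ∀ g ∈ D.charIdeal, ∃ h : IwasawaAlgebra 3,
          iwasawaToPowerSeries 3 g =
            iwasawaToPowerSeries 3 h *
              (PowerSeries.C ((ϖ : ℚ_[3]) * (ϖ' : ℚ_[3])) *
                (padicLFunction f ((unitRoot V 3 : ℤ_[3]) : ℚ_[3]) *
                  padicLFunctionMinusBranch f ((unitRoot V 3 : ℤ_[3]) : ℚ_[3]) 1)))

/- The typed Schneider input for ALL twist models `V`, `C` and ALL twisting transports `Tr`, at the datum `Dh`. -/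
variable {Dh : PAdicHeightData W 3}
    (hS1K : ∀ (V : WeierstrassCurve ℚ) [V.IsElliptic] [V.IsGloballyMinimal] (C : VariableChange ℚ),
      GoodOrd V 3 → C • V.quadraticTwist (-(3 : ℚ)) = W →
      ∀ (Tr : W.toAffine.Point →+ (V.baseChange (CyclotomicField 3 ℚ)).toAffine.Point),
      (∀ P : W.toAffine.Point, heightPairing (Tr P) (Tr P) = 2 * heightPairing P P) →
      ∀ (κ : ZpExtension (CyclotomicField 3 ℚ) 3) (γ : Field.absoluteGaloisGroup (CyclotomicField 3 ℚ)),
      κ.IsCyclotomic → κ.IsTopGenerator γ →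
      (∃ ζ : ℤ_[3]ˣ, IsOfFinOrder ζ ∧
        ((GaloisRep.cyclotomicCharacter (CyclotomicField 3 ℚ) 3 γ * ζ : ℤ_[3]ˣ) : ℤ_[3]) =
          (cyclotomicGenerator 3 : ℤ_[3])) →
      ∀ (D : (V.baseChange (CyclotomicField 3 ℚ)).SelmerDualData κ γ)
        [Module.Finite (IwasawaAlgebra 3) D.X], D.IsTorsion →
      ∀ (fE : IwasawaAlgebra 3), D.charIdeal = Ideal.span {fE} →
        (V.baseChange (CyclotomicField 3 ℚ)).mordellWeilRank = 1 →
        Finite (AddCommGroup.primaryComponent (V.baseChange (CyclotomicField 3 ℚ)).sha 3) →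
      ∀ (Q : (V.baseChange (CyclotomicField 3 ℚ)).toAffine.Point), IsMordellWeilBasis (fun _ : Fin 1 => Q) →
        PowerSeries.X ∣ fE ∧
        ∃ DK : PAdicHeightDataK V 3 (CyclotomicField 3 ℚ),
          (∀ P P' : W.toAffine.Point, DK.pairing (Tr P) (Tr P') = 2 * Dh.pairing P P') ∧
          ∃ u : ℤ_[3]ˣ,
            ((PowerSeries.coeff 1 fE : ℤ_[3]) : ℚ_[3]) * padicLog 3 (cyclotomicGenerator 3) *
                (Nat.card (AddCommGroup.primaryComponent
                  (V.baseChange (CyclotomicField 3 ℚ)).toAffine.Point 3) : ℚ_[3]) ^ 2 =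
              ((u : ℤ_[3]) : ℚ_[3]) * DK.pairing Q Q *
                (3 : ℚ_[3]) ^ (padicValNat 3 (V.baseChange (CyclotomicField 3 ℚ)).tamagawaProduct) *
                (Nat.card (AddCommGroup.primaryComponent
                  ((integralModelInt V).map (Int.castRingHom (ZMod 3))).toAffine.Point 3) : ℚ_[3]) ^ 2 *
                (Nat.card (AddCommGroup.primaryComponent (V.baseChange (CyclotomicField 3 ℚ)).sha 3) : ℚ_[3]))

include hLowK hS1K

/-- **X4♯(G-ord) at `3` ∧ `surj ∧ ram`, `r_an(E) = 1`, twist `E♭` of analytic rank ZERO, EVERY ROW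
(anomalous included): the LOWER half `ord₃ #Ш_an(E) ≤ ord₃ #Ш(E)`** ⟸ (⊇/K) and `hS1K` for the good
ordinary twist models of `E^{(−3)}` (per-row binders over all globally minimal `V`, `C` with `GoodOrd V 3`,
`C • V^{(−3)} = E` — a model exists by `ClassX4Gord.exists_goodOrd_pStar_twist_model` — and all twisting
transports `Tr`, which EXIST by `exists_twistTransport` since `√−3 ∈ ℚ(ζ₃)`), p01's typed GZ `hGZ` and the
Schneider rider `hS` at `Dh`; named facts Kato Thm. 17.4 (3) over `ℚ(ζ₃)`, Wuthrich Prop. 21, Milne,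
modularity, GZK. [cite: GreenbergLNM1716, §4 p. 110] [cite: Wuthrich2014, Prop. 21 (p. 400)]
[cite: Miller2011LMS, Def. 1.1] -/
theorem ClassX4Gord.missingLowerBoundAt_three_rankOne_twistRankZero_of_lowerK_of_schneiderK
    [Fact (Nat.Prime 3)]
    (hKato : Kato2004.charIdeal_dvd_padicLFunction_cyclotomicThree_of_surjective)
    (hWu : Wuthrich2014.sha_dvd_analyticSha)
    (hMilne : Milne1972.bsdQuotient_baseChange_quadratic_anyModel)
    (hGZK : rank_eq_analyticRank_of_analyticRank_le_one) (hmod : hasEntireLFunction_rat)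
    (hmodD : nonempty_modularParametrizationData)
    (hX : ClassX4Gord W 3) (hsurj : Surj W 3) (hram : Ram W 3) (hr : W.analyticRank = 1)
    (hrV : ∀ (V : WeierstrassCurve ℚ) [V.IsElliptic] [V.IsGloballyMinimal] (C : VariableChange ℚ),
      GoodOrd V 3 → C • V.quadraticTwist (-(3 : ℚ)) = W → V.analyticRank = 0)
    (hS : SchneiderConjecture Dh) (hGZ : BranchPAdicGrossZagierOddAt W 3 Dh) :
    MissingLowerBoundAt W 3 := by
  haveI : IsCyclotomicExtension {3} ℚ (CyclotomicField 3 ℚ) := CyclotomicField.isCyclotomicExtension 3 ℚ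
  obtain ⟨V, iV, iVm, C, hgo, hC⟩ := ClassX4Gord.exists_goodOrd_pStar_twist_model W 3 hX
    (semistabilityIndex_eq_two_of_typeG_three W hX.typeGOrd.typeG hX.addv.2)
  have hC' : C • V.quadraticTwist (-(3 : ℚ)) = W := by
    have h3 : ((-1 : ℚ) ^ ((3 : ℕ) / 2) * (3 : ℕ)) = -(3 : ℚ) := by norm_num
    rw [← h3]; exact hC
  -- a twisting transport exists: `√−3 ∈ ℚ(ζ₃)`
  obtain ⟨θ, hθ2⟩ := exists_sq_eq_pStar 3 (CyclotomicField 3 ℚ) (by norm_num)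
  have hθ3 : θ ^ 2 = algebraMap ℚ (CyclotomicField 3 ℚ) (-(3 : ℚ)) := by
    rw [hθ2]; push_cast; norm_num
  have hθ : θ ∉ Set.range (algebraMap ℚ (CyclotomicField 3 ℚ)) := by
    rintro ⟨q, hq⟩
    apply forall_sq_ne_pStar 3 q
    have h : algebraMap ℚ (CyclotomicField 3 ℚ) (q ^ 2) =
        algebraMap ℚ (CyclotomicField 3 ℚ) ((-1 : ℚ) ^ ((3 : ℕ) / 2) * (3 : ℕ)) := by
      rw [map_pow, hq, hθ3]; push_cast; norm_num
    exact (algebraMap ℚ (CyclotomicField 3 ℚ)).injective h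
  obtain ⟨Tr, hTr⟩ := exists_twistTransport (CyclotomicField 3 ℚ) V W
    (finrank_eq_two_of_isCyclotomicExtension_three (K := CyclotomicField 3 ℚ)) hθ hθ3 C hC'
  exact XGordRankOneZeroCyclotomicThreeLowerK.missingLowerBoundAt_of_surj_of_ram V W
    (fun hκ hγ hγ' hf D ϖ ϖ' hϖ hϖ' g hg ↦ hLowK V C hgo hC' hκ hγ hγ' hf D ϖ ϖ' hϖ hϖ' g hg) Tr Dh
    (hS1K V C hgo hC' Tr hTr) hKato hWu hMilne hGZK hmod hmodD C hC' hTr hgo hsurj hram hX.addv.2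
    (hrV V C hgo hC') hr hS hGZ

/-- **X4♯(G-ord) at `3` ∧ `surj ∧ ram`, `r_an(E) = 1`, twist of analytic rank ZERO, EVERY ROW (anomalous
included): `BSD(E,3)`** ⟸ (⊇/K) + `hS1K` (schemata as above) + p01's typed GZ + the Schneider rider at a
Delbourgo (B)-datum `Dh` (`hB`), and the named facts Kato Thm. 17.4 (3) over `ℚ(ζ₃)` (`hKato`), its
half-eigen reading (`hK`, p01's UPPER half), Wuthrich Prop. 21 (`hWu`), Milne, modularity, GZK. The one
non-fact inputs are THREE typed statements — (⊇/K) = PLAN §1.2 II.3's wall at `p = 3`, the Schneider/K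
reading `hS1K`, and seat p01's `BranchPAdicGrossZagierOddAt W 3 Dh`; X4♯(G-ord) / O7 stay
CONSTRUCTION-SHAPED; nothing booked. [cite: Kato2004Asterisque, Thm. 17.4 (3) (p. 273)]
[cite: Delbourgo2002, Theorem (B) (p. 40)] [cite: Wuthrich2014, Prop. 21 (p. 400)]
[cite: GreenbergLNM1716, §4 p. 110] [cite: Miller2011LMS, Def. 1.1] -/
theorem ClassX4Gord.bsdp_three_rankOne_twistRankZero_of_lowerK_of_schneiderK_of_katoHalf
    [Fact (Nat.Prime 3)]
    (hKato : Kato2004.charIdeal_dvd_padicLFunction_cyclotomicThree_of_surjective)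
    (hK : Wuthrich2014.kato_halfEigenCharIdeal_dvd_cyclotomicPrime_of_surjective)
    (hWu : Wuthrich2014.sha_dvd_analyticSha)
    (hMilne : Milne1972.bsdQuotient_baseChange_quadratic_anyModel)
    (hGZK : rank_eq_analyticRank_of_analyticRank_le_one) (hmod : hasEntireLFunction_rat)
    (hmodD : nonempty_modularParametrizationData)
    (hX : ClassX4Gord W 3) (hsurj : Surj W 3) (hram : Ram W 3) (hr : W.analyticRank = 1)
    (hrV : ∀ (V : WeierstrassCurve ℚ) [V.IsElliptic] [V.IsGloballyMinimal] (C : VariableChange ℚ),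
      GoodOrd V 3 → C • V.quadraticTwist (-(3 : ℚ)) = W → V.analyticRank = 0)
    (hB : LeadingTermClauses W 3 Dh) (hS : SchneiderConjecture Dh) (hGZ : BranchPAdicGrossZagierOddAt W 3 Dh) :
    BSDp W 3 := by
  haveI : IsCyclotomicExtension {3} ℚ (CyclotomicField 3 ℚ) := CyclotomicField.isCyclotomicExtension 3 ℚ
  obtain ⟨V, iV, iVm, C, hgo, hC⟩ := ClassX4Gord.exists_goodOrd_pStar_twist_model W 3 hX
    (semistabilityIndex_eq_two_of_typeG_three W hX.typeGOrd.typeG hX.addv.2)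
  have hC' : C • V.quadraticTwist (-(3 : ℚ)) = W := by
    have h3 : ((-1 : ℚ) ^ ((3 : ℕ) / 2) * (3 : ℕ)) = -(3 : ℚ) := by norm_num
    rw [← h3]; exact hC
  obtain ⟨θ, hθ2⟩ := exists_sq_eq_pStar 3 (CyclotomicField 3 ℚ) (by norm_num)
  have hθ3 : θ ^ 2 = algebraMap ℚ (CyclotomicField 3 ℚ) (-(3 : ℚ)) := by
    rw [hθ2]; push_cast; norm_num
  have hθ : θ ∉ Set.range (algebraMap ℚ (CyclotomicField 3 ℚ)) := by
    rintro ⟨q, hq⟩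
    apply forall_sq_ne_pStar 3 q
    have h : algebraMap ℚ (CyclotomicField 3 ℚ) (q ^ 2) =
        algebraMap ℚ (CyclotomicField 3 ℚ) ((-1 : ℚ) ^ ((3 : ℕ) / 2) * (3 : ℕ)) := by
      rw [map_pow, hq, hθ3]; push_cast; norm_num
    exact (algebraMap ℚ (CyclotomicField 3 ℚ)).injective h
  obtain ⟨Tr, hTr⟩ := exists_twistTransport (CyclotomicField 3 ℚ) V W
    (finrank_eq_two_of_isCyclotomicExtension_three (K := CyclotomicField 3 ℚ)) hθ hθ3 C hC'
  exact (XGordRankOneZeroCyclotomicThreeLowerK.bsdp_three_and_twist_of_katoHalf_of_leadingTermClauses_of_surj_of_ram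
    V W (fun hκ hγ hγ' hf D ϖ ϖ' hϖ hϖ' g hg ↦ hLowK V C hgo hC' hκ hγ hγ' hf D ϖ ϖ' hϖ hϖ' g hg) Tr Dh
    (hS1K V C hgo hC' Tr hTr) hKato hK hWu hMilne hGZK hmod hmodD C hC' hTr hgo hX hsurj hram
    (hrV V C hgo hC') hr hB hS hGZ).1

end ClassForms

end Summit.BirchSwinnertonDyer.Rank1Residual.Additive

end
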